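import Mathlib.MeasureTheory.Integral.Pi
import Mathlib.MeasureTheory.Integral.Prod
import Mathlib.MeasureTheory.Measure.Lebesgue.Basic
import Mathlib.Analysis.SpecialFunctions.Integrals.Basic
import Mathlib.Analysis.Normed.Operator.ContinuousLinearMap

/-!
# `BalabanUV.Beta.FP.BoxAverageMoments` — road «FP» for binder row D1, N7 PLAN v1 §3, row «N7/GERM-x» of `LEAVES-FP.md`, PART 1 of 2:
# THE CENTRED UNIT BOX OF `ι → ℝ`, ITS LOW MOMENTS, AND «THE BOX-PAIR AVERAGE OF A TRACELESS QUADRATIC FORM VANISHES»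
# (β sub-cell; CROSS-LANE supplier seat `b2b-balaban-gan24-formalise-leaf-04` (G-an2-4 formalisation swarm, gen 36) on the road-FP owner's
# invitation «GERM-x LEMMA (Mathlib-only, swarm-ready NOW)», journal l.16935; claim l.16989; part 2 = `FP/BoxAverageGerm`)

NOT IN PRINT AS SUCH; OUR BOOKKEEPING (elementary measure theory on the product box).  HONEST FRAMING (cell charter, verbatim): «discharging
`BetaPertH` makes Bałaban's UV stability UNCONDITIONAL — a real constructive-QFT result; it is NOT the continuum limit and NOT the Clay problem.»
HONEST DEPENDENCY (verbatim): «continuum YM on T⁴ ⇐ BetaPertH ∧ nine spine estimates (0/9 proved); BetaPertH ⇐ (D1) ∧ (D4) ∧ CAP+tail; G-an2-4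
gates asym, D1 and NE2/3/4.»  ABSOLUTE RULE (cell, verbatim): «No internally-minted statement may enter as a cited fact. Every hypothesis is either
kernel-proved in this package or a verbatim quotation of a PUBLISHED theorem with page reference.»  Nothing is cited; ONE data `def` (`box`); no
`def … : Prop`; Mathlib only; NO road input, NO statement about Bałaban's papers; discharges NOTHING of N7 ∕ D1; NOT `BetaPertH`, NOT continuum, NOT Clay.

SETTING.  `ι` a finite index type; `ι → ℝ` with Mathlib's SUP norm and product Lebesgue measure `volume`; `box ι := Icc (−½) ½`; `e_i := Pi.single i 1`.
CONTENT.
* §3 [our object] `box`; [folklore] `mem_box_iff`, `box_eq_pi`, `isCompact_box`, `measurableSet_box`, `volume_box(_toReal) = 1`,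
  `norm_sub_le_one_of_mem_box`, `volume_restrict_box` (`Measure.restrict_pi_pi`), **`integral_box_prod`** (Fubini for product integrands,
  `integral_fintype_prod_eq_prod`), `integral_halfIcc_one/_id/_sq` (`= 1, 0, 1/12`), **`integral_box_coord = 0`**, **`integral_box_coord_mul = δ_{ik}/12`**.
* §4 [folklore] **`bilin_apply_eq_sum`** (`B u v = Σ_i Σ_k u_i v_k B(e_i)(e_k)`),
  `integrableOn_boxProd_of_continuous`, `integral_box_one`, **`integral_boxProd_sub_mul_sub`** (`∫_{box×box} (u−v)_i (u−v)_k = δ_{ik}/6`),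
  **`integral_boxProd_bilin_eq_zero`** (`Σ_i B(e_i)(e_i) = 0 ⇒ ∫_{box×box} B(u−v)(u−v) = 0`).
Provenance: unit `b2b-balaban-gan24-formalise-leaf-04` (gen 36), 2026-08-20; no existing file touched.  0 sorry.
-/

noncomputable section

open Set MeasureTheory Finset

namespace Summit.QuantumFields.BalabanUV.Beta.FP.BoxAverageMoments

/-! ## §3 The unit box of `ι → ℝ` and its low moments -/

section Box

variable (ι : Type*) [Fintype ι]

/-- [our object] The centred unit box `[-½, ½]^ι` of `ι → ℝ` (sup norm: the closed ball of radius `½`). -/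
def box : Set (ι → ℝ) := Icc (fun _ => -(1 / 2 : ℝ)) (fun _ => (1 / 2 : ℝ))

variable {ι}

omit [Fintype ι] in
/-- [folklore] Membership in the box, coordinatewise. -/
theorem mem_box_iff {u : ι → ℝ} : u ∈ box ι ↔ ∀ i, -(1 / 2 : ℝ) ≤ u i ∧ u i ≤ 1 / 2 := by
  simp only [box, Set.mem_Icc, Pi.le_def]
  exact ⟨fun h i => ⟨h.1 i, h.2 i⟩, fun h => ⟨fun i => (h i).1, fun i => (h i).2⟩⟩

omit [Fintype ι] in
/-- [folklore] The box is the product of intervals. -/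
theorem box_eq_pi : box ι = Set.univ.pi fun _ : ι => Icc (-(1 / 2 : ℝ)) (1 / 2) := by
  rw [box, ← Set.pi_univ_Icc]

omit [Fintype ι] in
/-- [folklore] The box is compact. -/
theorem isCompact_box : IsCompact (box ι) := isCompact_Icc

/-- [folklore] The box is measurable. -/
theorem measurableSet_box : MeasurableSet (box ι) := measurableSet_Icc

/-- [folklore] The box has volume one. -/
theorem volume_box_toReal : (volume (box ι)).toReal = 1 := by
  rw [box, Real.volume_Icc_pi_toReal (fun _ => by norm_num)]
  norm_num

/-- [folklore] The box has volume one (`ℝ≥0∞` form). -/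
theorem volume_box : volume (box ι) = 1 := by
  have h := volume_box_toReal (ι := ι)
  rw [ENNReal.toReal_eq_one_iff] at h
  exact h

/-- [folklore] Differences of box points have sup norm at most one. -/
theorem norm_sub_le_one_of_mem_box {u v : ι → ℝ} (hu : u ∈ box ι) (hv : v ∈ box ι) : ‖u - v‖ ≤ 1 := by
  rw [pi_norm_le_iff_of_nonneg zero_le_one]
  intro i
  rw [Pi.sub_apply, Real.norm_eq_abs, abs_le]
  have hu' := (mem_box_iff.mp hu) i
  have hv' := (mem_box_iff.mp hv) i
  constructor <;> linarith [hu'.1, hu'.2, hv'.1, hv'.2]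

/-- [folklore] Lebesgue measure restricted to the box is the product of the restricted one-dimensional measures. -/
theorem volume_restrict_box :
    (volume : Measure (ι → ℝ)).restrict (box ι) = Measure.pi fun _ : ι => (volume : Measure ℝ).restrict (Icc (-(1 / 2 : ℝ)) (1 / 2)) := by
  rw [box_eq_pi, volume_pi, Measure.restrict_pi_pi]

/-- [folklore] **FUBINI ON THE BOX FOR PRODUCT INTEGRANDS**: `∫_{box} ∏_i h_i (x_i) = ∏_i ∫_{[-½,½]} h_i`. -/
theorem integral_box_prod (h : ι → ℝ → ℝ) :
    ∫ x in box ι, ∏ i, h i (x i) = ∏ i, ∫ t in Icc (-(1 / 2 : ℝ)) (1 / 2), h i t := by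
  rw [volume_restrict_box, integral_fintype_prod_eq_prod]

/-- [folklore] `∫_{[-½,½]} 1 = 1`. -/
theorem integral_halfIcc_one : ∫ _t in Icc (-(1 / 2 : ℝ)) (1 / 2), (1 : ℝ) = 1 := by
  rw [integral_Icc_eq_integral_Ioc, ← intervalIntegral.integral_of_le (by norm_num)]
  simp only [intervalIntegral.integral_const, smul_eq_mul, mul_one]
  norm_num

/-- [folklore] `∫_{[-½,½]} t dt = 0`. -/
theorem integral_halfIcc_id : ∫ t in Icc (-(1 / 2 : ℝ)) (1 / 2), t = 0 := by
  rw [integral_Icc_eq_integral_Ioc, ← intervalIntegral.integral_of_le (by norm_num), integral_id]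
  norm_num

/-- [folklore] `∫_{[-½,½]} t² dt = 1/12`. -/
theorem integral_halfIcc_sq : ∫ t in Icc (-(1 / 2 : ℝ)) (1 / 2), t ^ 2 = 1 / 12 := by
  rw [integral_Icc_eq_integral_Ioc, ← intervalIntegral.integral_of_le (by norm_num), integral_pow]
  norm_num

variable [DecidableEq ι]

/-- [folklore] **FIRST MOMENTS VANISH**: `∫_{box} x_i dx = 0`. -/
theorem integral_box_coord (i : ι) : ∫ x in box ι, x i = 0 := by
  have h := integral_box_prod (ι := ι) (fun l t => if l = i then t else 1)
  have e : (fun x : ι → ℝ => ∏ l, (fun l t => if l = i then t else (1 : ℝ)) l (x l)) = fun x => x i := by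
    funext x
    simp only
    rw [Finset.prod_ite_eq']
    simp
  rw [e] at h
  rw [h]
  have e2 : ∀ l, (∫ t in Icc (-(1 / 2 : ℝ)) (1 / 2), (fun l t => if l = i then t else (1 : ℝ)) l t)
      = if l = i then (0 : ℝ) else 1 := by
    intro l
    by_cases hl : l = i
    · simp only [hl, if_true]; exact integral_halfIcc_id
    · simp only [hl, if_false]; exact integral_halfIcc_one
  simp_rw [e2]
  rw [Finset.prod_ite_eq']
  simp

/-- [folklore] **SECOND MOMENTS**: `∫_{box} x_i x_k dx = δ_{ik} / 12`. -/
theorem integral_box_coord_mul (i k : ι) : ∫ x in box ι, x i * x k = if i = k then 1 / 12 else 0 := by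
  by_cases hik : i = k
  · subst hik
    simp only [if_true]
    have h := integral_box_prod (ι := ι) (fun l t => if l = i then t ^ 2 else 1)
    have e : (fun x : ι → ℝ => ∏ l, (fun l t => if l = i then t ^ 2 else (1 : ℝ)) l (x l)) = fun x => x i * x i := by
      funext x
      simp only
      rw [Finset.prod_ite_eq']
      simp [sq]
    rw [e] at h
    rw [h]
    have e2 : ∀ l, (∫ t in Icc (-(1 / 2 : ℝ)) (1 / 2), (fun l t => if l = i then t ^ 2 else (1 : ℝ)) l t)
        = if l = i then (1 / 12 : ℝ) else 1 := by
      intro l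
      by_cases hl : l = i
      · simp only [hl, if_true]; exact integral_halfIcc_sq
      · simp only [hl, if_false]; exact integral_halfIcc_one
    simp_rw [e2]
    rw [Finset.prod_ite_eq']
    simp
  · simp only [hik, if_false]
    have h := integral_box_prod (ι := ι) (fun l t => if l = i then t else if l = k then t else 1)
    have e : (fun x : ι → ℝ => ∏ l, (fun l t => if l = i then t else if l = k then t else (1 : ℝ)) l (x l))
        = fun x => x i * x k := by
      funext x
      simp only
      rw [Finset.prod_eq_mul i k hik]
      · simp [Ne.symm hik]
      · intro c _ hc; simp [hc.1, hc.2]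
      · intro hi; exact absurd (Finset.mem_univ i) hi
      · intro hk; exact absurd (Finset.mem_univ k) hk
    rw [e] at h
    rw [h]
    refine Finset.prod_eq_zero (Finset.mem_univ i) ?_
    simp only [if_true]
    exact integral_halfIcc_id

end Box


/-! ## §4 The box-pair average of a traceless quadratic form vanishes -/

section Quadratic

variable {ι : Type*} [Fintype ι] [DecidableEq ι]

/-- [folklore] **COORDINATE EXPANSION OF A BILINEAR FORM** on `ι → ℝ`: `B u v = Σ_i Σ_k u_i v_k B(e_i)(e_k)`
(the vector identity `u = Σ_i u_i • e_i` is the tree's `Literature.ModelTheory.ExponentialFields.Desingularisation.eq_sum_smul_single`;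
re-derived inline as a `have` to keep this brick's imports measure-theoretic). -/
theorem bilin_apply_eq_sum (B : (ι → ℝ) →L[ℝ] (ι → ℝ) →L[ℝ] ℝ) (u v : ι → ℝ) :
    B u v = ∑ i, ∑ k, u i * v k * B (Pi.single i 1) (Pi.single k 1) := by
  have hexp : ∀ y : ι → ℝ, y = ∑ i, y i • (Pi.single i (1 : ℝ) : ι → ℝ) := fun y => by
    ext j
    simp [Finset.sum_apply, Pi.single_apply]
  conv_lhs => rw [hexp u, hexp v]
  rw [map_sum B (fun i => u i • (Pi.single i (1 : ℝ) : ι → ℝ)) Finset.univ, _root_.sum_apply]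
  refine Finset.sum_congr rfl fun i _ => ?_
  rw [map_sum (B (u i • (Pi.single i (1 : ℝ) : ι → ℝ))) (fun k => v k • (Pi.single k (1 : ℝ) : ι → ℝ)) Finset.univ]
  refine Finset.sum_congr rfl fun k _ => ?_
  rw [map_smul, map_smul, _root_.smul_apply, smul_eq_mul, smul_eq_mul]
  ring

omit [DecidableEq ι] in
/-- [folklore] Continuous functions are integrable on the (compact) box pair. -/
theorem integrableOn_boxProd_of_continuous {g : (ι → ℝ) × (ι → ℝ) → ℝ} (hg : Continuous g) :
    IntegrableOn g (box ι ×ˢ box ι) ((volume : Measure (ι → ℝ)).prod volume) :=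
  hg.continuousOn.integrableOn_compact (isCompact_box.prod isCompact_box)

omit [DecidableEq ι] in
/-- [folklore] `∫_{box} 1 = 1`. -/
theorem integral_box_one : ∫ _x in box ι, (1 : ℝ) = 1 := by
  rw [setIntegral_const, smul_eq_mul, mul_one]
  exact volume_box_toReal (ι := ι)

/-- [folklore] **SECOND MOMENTS OF THE DIFFERENCE VARIABLE ON THE BOX PAIR**:
`∫_{box×box} (u−v)_i (u−v)_k = δ_{ik} / 6`. -/
theorem integral_boxProd_sub_mul_sub (i k : ι) :
    ∫ p in box ι ×ˢ box ι, (p.1 i - p.2 i) * (p.1 k - p.2 k) ∂((volume : Measure (ι → ℝ)).prod volume)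
      = if i = k then 1 / 6 else 0 := by
  have J1 : ∫ p in box ι ×ˢ box ι, p.1 i * p.1 k ∂((volume : Measure (ι → ℝ)).prod volume) = if i = k then 1 / 12 else 0 := by
    have h := setIntegral_prod_mul (μ := (volume : Measure (ι → ℝ))) (ν := (volume : Measure (ι → ℝ)))
      (fun u : ι → ℝ => u i * u k) (fun _ : ι → ℝ => (1 : ℝ)) (box ι) (box ι)
    simp only [mul_one] at h
    rw [h, integral_box_coord_mul, integral_box_one, mul_one]
  have J2 : ∫ p in box ι ×ˢ box ι, p.1 i * p.2 k ∂((volume : Measure (ι → ℝ)).prod volume) = 0 := by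
    have h := setIntegral_prod_mul (μ := (volume : Measure (ι → ℝ))) (ν := (volume : Measure (ι → ℝ)))
      (fun u : ι → ℝ => u i) (fun v : ι → ℝ => v k) (box ι) (box ι)
    rw [h, integral_box_coord, zero_mul]
  have J3 : ∫ p in box ι ×ˢ box ι, p.1 k * p.2 i ∂((volume : Measure (ι → ℝ)).prod volume) = 0 := by
    have h := setIntegral_prod_mul (μ := (volume : Measure (ι → ℝ))) (ν := (volume : Measure (ι → ℝ)))
      (fun u : ι → ℝ => u k) (fun v : ι → ℝ => v i) (box ι) (box ι)
    rw [h, integral_box_coord, zero_mul]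
  have J4 : ∫ p in box ι ×ˢ box ι, p.2 i * p.2 k ∂((volume : Measure (ι → ℝ)).prod volume) = if i = k then 1 / 12 else 0 := by
    have h := setIntegral_prod_mul (μ := (volume : Measure (ι → ℝ))) (ν := (volume : Measure (ι → ℝ)))
      (fun _ : ι → ℝ => (1 : ℝ)) (fun v : ι → ℝ => v i * v k) (box ι) (box ι)
    simp only [one_mul] at h
    rw [h, integral_box_coord_mul, integral_box_one, one_mul]
  have e : (fun p : (ι → ℝ) × (ι → ℝ) => (p.1 i - p.2 i) * (p.1 k - p.2 k))
      = fun p => p.1 i * p.1 k - p.1 i * p.2 k - p.1 k * p.2 i + p.2 i * p.2 k := by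
    funext p; ring
  have I1 : IntegrableOn (fun p : (ι → ℝ) × (ι → ℝ) => p.1 i * p.1 k) (box ι ×ˢ box ι) ((volume : Measure (ι → ℝ)).prod volume) :=
    integrableOn_boxProd_of_continuous (by fun_prop)
  have I2 : IntegrableOn (fun p : (ι → ℝ) × (ι → ℝ) => p.1 i * p.2 k) (box ι ×ˢ box ι) ((volume : Measure (ι → ℝ)).prod volume) :=
    integrableOn_boxProd_of_continuous (by fun_prop)
  have I3 : IntegrableOn (fun p : (ι → ℝ) × (ι → ℝ) => p.1 k * p.2 i) (box ι ×ˢ box ι) ((volume : Measure (ι → ℝ)).prod volume) :=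
    integrableOn_boxProd_of_continuous (by fun_prop)
  have I4 : IntegrableOn (fun p : (ι → ℝ) × (ι → ℝ) => p.2 i * p.2 k) (box ι ×ˢ box ι) ((volume : Measure (ι → ℝ)).prod volume) :=
    integrableOn_boxProd_of_continuous (by fun_prop)
  rw [e, integral_add ?_ I4, integral_sub ?_ I3, integral_sub I1 I2, J1, J2, J3, J4]
  · by_cases hik : i = k
    · simp [hik]; norm_num
    · simp [hik]
  · exact I1.sub I2
  · exact (I1.sub I2).sub I3

/-- [folklore] **THE BOX-PAIR AVERAGE OF A TRACELESS QUADRATIC FORM VANISHES**: for a continuous bilinear form `B` on `ι → ℝ` with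
`Σ_i B(e_i)(e_i) = 0`, `∫_{box×box} B(u − v)(u − v) = 0` — cross moments vanish, diagonal moments are all `1/6`. -/
theorem integral_boxProd_bilin_eq_zero (B : (ι → ℝ) →L[ℝ] (ι → ℝ) →L[ℝ] ℝ)
    (hB : ∑ i, B (Pi.single i 1) (Pi.single i 1) = 0) :
    ∫ p in box ι ×ˢ box ι, B (p.1 - p.2) (p.1 - p.2) ∂((volume : Measure (ι → ℝ)).prod volume) = 0 := by
  have e : (fun p : (ι → ℝ) × (ι → ℝ) => B (p.1 - p.2) (p.1 - p.2))
      = fun p => ∑ i, ∑ k, (p.1 i - p.2 i) * (p.1 k - p.2 k) * B (Pi.single i 1) (Pi.single k 1) := by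
    funext p; rw [bilin_apply_eq_sum]; rfl
  have hterm : ∀ i k, IntegrableOn (fun p : (ι → ℝ) × (ι → ℝ) => (p.1 i - p.2 i) * (p.1 k - p.2 k) * B (Pi.single i 1) (Pi.single k 1))
      (box ι ×ˢ box ι) ((volume : Measure (ι → ℝ)).prod volume) := fun i k =>
    integrableOn_boxProd_of_continuous (by fun_prop)
  rw [e, integral_finsetSum _ (fun i _ => integrable_finsetSum _ (fun k _ => hterm i k))]
  have inner : ∀ i, ∫ p in box ι ×ˢ box ι, ∑ k, (p.1 i - p.2 i) * (p.1 k - p.2 k) * B (Pi.single i 1) (Pi.single k 1)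
      ∂((volume : Measure (ι → ℝ)).prod volume) = (1 / 6 : ℝ) * B (Pi.single i 1) (Pi.single i 1) := by
    intro i
    rw [integral_finsetSum _ (fun k _ => hterm i k)]
    have hk : ∀ k, ∫ p in box ι ×ˢ box ι, (p.1 i - p.2 i) * (p.1 k - p.2 k) * B (Pi.single i 1) (Pi.single k 1)
        ∂((volume : Measure (ι → ℝ)).prod volume)
        = (if i = k then 1 / 6 else 0 : ℝ) * B (Pi.single i 1) (Pi.single k 1) := by
      intro k
      rw [integral_mul_const, integral_boxProd_sub_mul_sub]
    simp_rw [hk]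
    simp
  simp_rw [inner, ← Finset.mul_sum, hB, mul_zero]

end Quadratic


end Summit.QuantumFields.BalabanUV.Beta.FP.BoxAverageMoments

end
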